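import Summits.QuantumFields.BalabanUV.T4Continuum.Support.RegionElectricHessian
import Summits.QuantumFields.BalabanUV.T4Continuum.Support.RegionLocalInjectedPairing

/-!
# T⁴ programme, spine node NE2 (U1a), sub-row Δ1 «NE2⁰-Dirichlet» — THE (R)-BUDGETS OF THE LOCAL PROPAGATOR `G̃ = Δ_loc(Ω₀)⁻¹` ON BOX TOWERS, and
# THE (R-loc) SOCKET OF THE OWNER'S LOCAL ASSEMBLY DISCHARGED: `∀ k f, Σ_μ ‖W_μ (G̃_k f)‖² ≤ CHbox²·‖f‖²`, `CHbox = 1 + (a + 7d)·γ⋆⁻¹`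

NE2 formalisation swarm `b2b-balaban-t4-ne2-formalise-*`, LEAF PROVER 02 (gen 8), supplier item «Δ1-LOC-HESS» = (R-loc), file 4 (the budget ledger), on
files 1–3 `Support/RegionElectric{Splitting,Commutation,Hessian}` (p238744 / p239036 / p239391) and the owner's O15-a/b `Support/RegionGaugeResolventSplit`
(p238371: `regionDeltaLoc`) / `Support/RegionLocalInjectedPairing` (`interiorW2_loc`, `coercive_regionDeltaLoc_lev_box`, `opNorm_inv_regionDeltaLoc_lev_box_le`
— USED BY NAME, not restated).  Owner O15-c «Δ1-VEC-W3-LOCAL-ASSEMBLY» (journal 2026-08-20 l.≈22472) displays the (R-loc) socket VERBATIM as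
`hRH : ∀ (k : ℕ) (f : pidx L M (starP L M S) k → ℂ), Σ_μ nsq (Wdir (lev L k) M S μ *ᵥ ((regionDeltaLoc (lev L k) M a S)⁻¹ *ᵥ f)) ≤ CH ^ 2 * nsq f`;
§3's **`hRH_box`** IS that statement, for every coordinate box, `L ≥ 2`, `0 < a`, `0 < a′`, with `CH = CHbox d a a′`.

 * §1 forms (any region / H1): `form_regionDeltaLoc`, `form_regionDeltaLoc_electric` (H1: `re⟨A, Δ_loc A⟩ = Σ_μ (‖igrad_μ A‖² + n²·Σ_b tcnt μ b‖A b‖²)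
   + a n^d‖avgR A‖²`), `electric_le_form_loc`, **`tcharge_le_form_loc`** (the transverse = tangential boundary-layer charges are dominated by the form —
   the own-direction zero-extension charge is NOT, slab mode), `form_inv_le_of_coercive`.
 * §2 crude level-`n` bounds valid on ANY region (used only at the unit level `k = 0`, where H1 may fail): `nsq_Gop_le` / **`nsq_igrad_le`**
   (`‖igrad_μ w‖² ≤ 4n²‖w‖²`), `opNorm_Idiff_le` (`‖Idiff μ‖ ≤ 2n`), `tcnt_le_two`, **`nsq_Wdir_mulVec_le`** (`‖W_μ A‖² ≤ 40n⁴‖A‖²`).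
 * §3 the box tower (`γ⋆ = gamStar d a′ (cW1box d a a′ 4)`, the owner's constant): `nsq_loc_inv_le`, **`form_loc_inv_le`** (`re⟨G̃_k f, f⟩ ≤ γ⋆⁻¹‖f‖²`,
   every k), **`electric_loc_inv_le`** (every k), `sum_nsq_igrad_loc_inv_le` / **`tcharge_loc_inv_le`** (levels `k + 1`: `≤ γ⋆⁻¹‖f‖²`),
   **`hessian_loc_inv_le`** (levels `k + 1`: `√(Σ_μ ‖W_μ G̃f‖²) ≤ (1 + aγ⋆⁻¹)‖f‖`), `hessian_loc_inv_le_crude` (every k: `≤ 40 d n_k⁴ γ⋆⁻²‖f‖²`), and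
   THE SOCKET **`hRH_box : ∀ k f, Σ_μ nsq (Wdir (lev L k) M S μ *ᵥ (G̃_k f)) ≤ (CHbox d a a′)² * nsq f`**, `CHbox d a a′ := 1 + (a + 7d)·γ⋆⁻¹`
   (level `0` by the crude bound at `n = 1`, levels `k + 1` by the corner-free H²).  Every constant is free of `k`, `M` and the box.

HONEST FRAMING (T4-DAG p. 1).  Lattice calculus at MODEL level (`U = 1`, ONE region = a coordinate box, ONE averaging scale, finite torus, operator
norm); statements OURS ([folklore]); nothing printed is a hypothesis; the (P-W) socket of O15-c ((P-gaffney), leaf-03-g8 / leaf-01-g10) and the leaves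
(B)/(Bᵗ) (leaf-05-g9 / leaf-06-g7) are OTHER seats' items and OPEN; `hinjK` / W3 on boxes OPEN; Δ1 NOT closed; NE2 (U1a) NOT proved; spine PROVED 0/9
unchanged; NOT [B9] (3.16)/(3.23)–(3.27)/(3.42) as printed; NOT infinite volume, NOT a mass gap, NOT the Clay problem.  HONEST DEPENDENCY: continuum YM on
T⁴ ⇐ BetaPertH ∧ nine spine estimates (0/9 proved); BetaPertH ⇐ (D1) ∧ (D4) ∧ CAP+tail; G-an2-4 gates asym, D1 and NE2/3/4.  No `sorry`.
-/

noncomputable section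

open scoped BigOperators ComplexConjugate Matrix Matrix.Norms.L2Operator
open Finset

namespace Summit.QuantumFields.BalabanUV.T4Continuum.RegionLocalBudgets

open Literature.MathematicalPhysics.QuantumFieldTheory.Balaban1983to89.B5Prop11Plancherel (Tor fine unitVec)
open Literature.MathematicalPhysics.QuantumFieldTheory.Balaban1983to89.B5Prop11Lower (nsq nsq_nonneg nsq_mulVec_le)
open Literature.MathematicalPhysics.QuantumFieldTheory.Balaban1983to89.B5G183RateUnitTower (lev)
open Summit.QuantumFields.BalabanUV.T4Continuum
open Summit.QuantumFields.BalabanUV.T4Continuum.SubtypeCompression (Coercive nsq_ext)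
open Summit.QuantumFields.BalabanUV.T4Continuum.ScalarAveragedPropagator (re_star_dotProduct_le)
open Summit.QuantumFields.BalabanUV.T4Continuum.ScalarBlockPoincare (nsq_add_le)
open Summit.QuantumFields.BalabanUV.T4Continuum.CovariantBlockAveraging (opNorm_le_of_sq_le')
open Summit.QuantumFields.BalabanUV.T4Continuum.RegionGaugeFixedVector (starReg curlR gradR avgR regionDeltaA)
open Summit.QuantumFields.BalabanUV.T4Continuum.DirichletSubregionTowerOf (pidx)
open Summit.QuantumFields.BalabanUV.T4Continuum.DirichletStarVectorTower (starP gamStar gamStar_pos two_le_lev_succ)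
open Summit.QuantumFields.BalabanUV.T4Continuum.DirichletStarRenormTower (igrad)
open Summit.QuantumFields.BalabanUV.T4Continuum.RegionStarBoundaryCharges (AtMostOneNeighbour atMostOneNeighbour_of_isCoordBox)
open Summit.QuantumFields.BalabanUV.T4Continuum.RegionElectricSplitting (Idiff Idiff_mulVec cnt1 tcnt tcnt_nonneg Wdir form_electric)
open Summit.QuantumFields.BalabanUV.T4Continuum.RegionElectricCommutation (Gop Dg Wdir_eq ext_Idiff_mulVec)
open Summit.QuantumFields.BalabanUV.T4Continuum.RegionElectricHessian (hessian_budget_loc)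
open Summit.QuantumFields.BalabanUV.T4Continuum.RegionGaugeResolventSplit (regionDeltaLoc form_localFixed)
open Summit.QuantumFields.BalabanUV.T4Continuum.RegionLocalInjectedPairing (interiorW2_loc coercive_regionDeltaLoc_lev_box
  opNorm_inv_regionDeltaLoc_lev_box_le)
open Summit.QuantumFields.BalabanUV.T4Continuum.RegionSliceCoerciveBoxTower (cW1box cW1box_pos)
open Summit.QuantumFields.BalabanUV.T4Continuum.RegionNormPairingTools (sqrt_nsq_mulVec_le)
open Summit.QuantumFields.BalabanUV.Beta.GAN24.DirichletBoxTwoLevel (IsCoordBox)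

variable {d : ℕ}

/-! ## §1 The forms of the local operator -/

section Region

variable (n : ℕ) [NeZero n] (M : Fin d → ℕ) [hM : ∀ μ, NeZero (M μ)] (S : Tor M → Prop) [DecidablePred S]

/-- the form of the local operator: `re⟨A, Δ_loc A⟩ = ‖curlR A‖² + ‖gradRᴴA‖² + a n^d·‖avgR A‖²`. [folklore] -/
theorem form_regionDeltaLoc (a : ℝ) (A : {b // starReg n M S b} → ℂ) :
    (star A ⬝ᵥ (regionDeltaLoc n M a S *ᵥ A)).re
      = nsq (curlR n M S *ᵥ A) + nsq ((gradR n M S)ᴴ *ᵥ A) + a * (n : ℝ) ^ d * nsq (avgR n M S *ᵥ A) := by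
  unfold regionDeltaLoc
  rw [form_localFixed]

/-- under H1 the form splits direction by direction: `re⟨A, Δ_loc A⟩ = Σ_μ (‖igrad_μ A‖² + n²·Σ_b tcnt μ b‖A b‖²) + a n^d·‖avgR A‖²`. [folklore] -/
theorem form_regionDeltaLoc_electric (hH : AtMostOneNeighbour n M S) (a : ℝ) (A : {b // starReg n M S b} → ℂ) :
    (star A ⬝ᵥ (regionDeltaLoc n M a S *ᵥ A)).re
      = ∑ μ, (nsq (igrad M S n μ A) + (n : ℝ) ^ 2 * ∑ b : {b // starReg n M S b}, tcnt n M S μ b.1 * ‖A b‖ ^ 2)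
          + a * (n : ℝ) ^ d * nsq (avgR n M S *ᵥ A) := by
  rw [form_regionDeltaLoc, form_electric n M S hH]

/-- the electric form is dominated by the local form (`0 ≤ a`): `‖curlR A‖² + ‖gradRᴴA‖² ≤ re⟨A, Δ_loc A⟩`. [folklore] -/
theorem electric_le_form_loc {a : ℝ} (ha : 0 ≤ a) (A : {b // starReg n M S b} → ℂ) :
    nsq (curlR n M S *ᵥ A) + nsq ((gradR n M S)ᴴ *ᵥ A) ≤ (star A ⬝ᵥ (regionDeltaLoc n M a S *ᵥ A)).re := by
  rw [form_regionDeltaLoc]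
  have := nsq_nonneg (avgR n M S *ᵥ A)
  have : 0 ≤ a * (n : ℝ) ^ d * nsq (avgR n M S *ᵥ A) := by positivity
  linarith

/-- **THE TRANSVERSE (TANGENTIAL BOUNDARY-LAYER) CHARGES ARE DOMINATED BY THE LOCAL FORM** (H1, `0 ≤ a`):
`Σ_μ n²·Σ_b tcnt μ b‖A b‖² ≤ re⟨A, Δ_loc A⟩` (the interior gradients are `RegionLocalInjectedPairing.interiorW2_loc`). [folklore] -/
theorem tcharge_le_form_loc (hH : AtMostOneNeighbour n M S) {a : ℝ} (ha : 0 ≤ a) (A : {b // starReg n M S b} → ℂ) :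
    ∑ μ, (n : ℝ) ^ 2 * ∑ b : {b // starReg n M S b}, tcnt n M S μ b.1 * ‖A b‖ ^ 2 ≤ (star A ⬝ᵥ (regionDeltaLoc n M a S *ᵥ A)).re := by
  rw [form_regionDeltaLoc_electric n M S hH, sum_add_distrib]
  have h1 : 0 ≤ ∑ μ, nsq (igrad M S n μ A) := sum_nonneg fun μ _ => nsq_nonneg _
  have := nsq_nonneg (avgR n M S *ᵥ A)
  have : 0 ≤ a * (n : ℝ) ^ d * nsq (avgR n M S *ᵥ A) := by positivity
  linarith

/-- the energy of a coercive inverse: `Δ_loc ≥ γ > 0` ⟹ for `A = G̃ f`, `re⟨A, Δ_loc A⟩ ≤ γ⁻¹‖f‖²`. [folklore] -/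
theorem form_inv_le_of_coercive {a γ : ℝ} (hγ : 0 < γ) (h : Coercive (regionDeltaLoc n M a S) γ) (f : {b // starReg n M S b} → ℂ) :
    (star ((regionDeltaLoc n M a S)⁻¹ *ᵥ f) ⬝ᵥ (regionDeltaLoc n M a S *ᵥ ((regionDeltaLoc n M a S)⁻¹ *ᵥ f))).re ≤ γ⁻¹ * nsq f := by
  set D := regionDeltaLoc n M a S
  have hunit : IsUnit D.det := SubtypeCompression.isUnit_det_of_coercive hγ h
  have hG : ‖D⁻¹‖ ≤ γ⁻¹ := SubtypeCompression.opNorm_inv_le_of_coercive hγ h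
  have hDD : D *ᵥ (D⁻¹ *ᵥ f) = f := by rw [Matrix.mulVec_mulVec, Matrix.mul_nonsing_inv _ hunit, Matrix.one_mulVec]
  rw [hDD]
  have h1 := re_star_dotProduct_le (D⁻¹ *ᵥ f) f
  have h2 : Real.sqrt (nsq (D⁻¹ *ᵥ f)) ≤ γ⁻¹ * Real.sqrt (nsq f) :=
    (sqrt_nsq_mulVec_le _ _).trans (mul_le_mul_of_nonneg_right hG (Real.sqrt_nonneg _))
  have h3 : Real.sqrt (nsq f) * Real.sqrt (nsq f) = nsq f := Real.mul_self_sqrt (nsq_nonneg _)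
  have h0 : 0 ≤ Real.sqrt (nsq f) := Real.sqrt_nonneg _
  calc _ ≤ Real.sqrt (nsq (D⁻¹ *ᵥ f)) * Real.sqrt (nsq f) := h1
    _ ≤ γ⁻¹ * Real.sqrt (nsq f) * Real.sqrt (nsq f) := mul_le_mul_of_nonneg_right h2 h0
    _ = γ⁻¹ * nsq f := by rw [mul_assoc, h3]

/-! ## §2 Crude level-`n` bounds on any region (used at the unit level only) -/

/-- `‖Gop μ f‖² ≤ 4n²·‖f‖²` on the ambient bond lattice. [folklore] -/
theorem nsq_Gop_le (μ : Fin d) (f : Tor (fine n M) × Fin d → ℂ) : nsq (Gop n M S μ f) ≤ 4 * (n : ℝ) ^ 2 * nsq f := by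
  have hshift : ∑ z : Tor (fine n M) × Fin d, ‖f (z.1 + unitVec (fine n M) μ, z.2)‖ ^ 2 = nsq f := by
    unfold nsq
    exact Fintype.sum_equiv (Equiv.prodCongr (Equiv.addRight (unitVec (fine n M) μ)) (Equiv.refl _)) _ _ (fun z => rfl)
  have hpt : ∀ z : Tor (fine n M) × Fin d,
      ‖Gop n M S μ f z‖ ^ 2 ≤ 2 * (n : ℝ) ^ 2 * (‖f (z.1 + unitVec (fine n M) μ, z.2)‖ ^ 2 + ‖f z‖ ^ 2) := by
    intro z
    have hA := norm_nonneg (f (z.1 + unitVec (fine n M) μ, z.2))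
    have hB := norm_nonneg (f z)
    unfold Gop
    split_ifs with h
    · rw [norm_mul, Complex.norm_natCast, mul_pow]
      have h1 : ‖f (z.1 + unitVec (fine n M) μ, z.2) - f z‖ ≤ ‖f (z.1 + unitVec (fine n M) μ, z.2)‖ + ‖f z‖ := norm_sub_le _ _
      have h2 : ‖f (z.1 + unitVec (fine n M) μ, z.2) - f z‖ ^ 2 ≤ 2 * (‖f (z.1 + unitVec (fine n M) μ, z.2)‖ ^ 2 + ‖f z‖ ^ 2) := by
        nlinarith [norm_nonneg (f (z.1 + unitVec (fine n M) μ, z.2) - f z), sq_nonneg (‖f (z.1 + unitVec (fine n M) μ, z.2)‖ - ‖f z‖)]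
      nlinarith [sq_nonneg (n : ℝ)]
    · rw [norm_zero, zero_pow two_ne_zero]
      positivity
  calc nsq (Gop n M S μ f) = ∑ z, ‖Gop n M S μ f z‖ ^ 2 := rfl
    _ ≤ ∑ z : Tor (fine n M) × Fin d, 2 * (n : ℝ) ^ 2 * (‖f (z.1 + unitVec (fine n M) μ, z.2)‖ ^ 2 + ‖f z‖ ^ 2) :=
        sum_le_sum fun z _ => hpt z
    _ = 2 * (n : ℝ) ^ 2 * (nsq f + nsq f) := by rw [← mul_sum, sum_add_distrib, hshift]; rfl
    _ = 4 * (n : ℝ) ^ 2 * nsq f := by ring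

/-- **`‖igrad_μ w‖² ≤ 4n²·‖w‖²`** on the star bonds of any region. [folklore] -/
theorem nsq_igrad_le (μ : Fin d) (w : {b // starReg n M S b} → ℂ) : nsq (igrad M S n μ w) ≤ 4 * (n : ℝ) ^ 2 * nsq w := by
  rw [← Idiff_mulVec, ← nsq_ext (starReg n M S) (Idiff n M S μ *ᵥ w), ext_Idiff_mulVec, ← nsq_ext (starReg n M S) w]
  exact nsq_Gop_le n M S μ _

/-- `‖Idiff μ‖ ≤ 2n`. [folklore] -/
theorem opNorm_Idiff_le (μ : Fin d) : ‖Idiff n M S μ‖ ≤ 2 * (n : ℝ) := by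
  refine opNorm_le_of_sq_le' _ (by positivity) fun x => ?_
  have h := nsq_igrad_le n M S μ x
  rw [← Idiff_mulVec] at h
  have e : (2 * (n : ℝ)) ^ 2 = 4 * (n : ℝ) ^ 2 := by ring
  rw [e]
  exact h

/-- `tcnt μ b ≤ 2`. [folklore] -/
theorem tcnt_le_two (μ : Fin d) (b : Tor (fine n M) × Fin d) : tcnt n M S μ b ≤ 2 := by
  unfold tcnt cnt1
  split_ifs <;> norm_num

/-- **`‖W_μ A‖² ≤ 40·n⁴·‖A‖²`** on any region at any level (crude: `‖Idiffᴴ·Idiff‖ ≤ 4n²`, `‖diag(n²tcnt)‖ ≤ 2n²`). [folklore] -/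
theorem nsq_Wdir_mulVec_le (μ : Fin d) (A : {b // starReg n M S b} → ℂ) : nsq (Wdir n M S μ *ᵥ A) ≤ 40 * (n : ℝ) ^ 4 * nsq A := by
  have hn : (0 : ℝ) ≤ n := Nat.cast_nonneg _
  rw [Wdir_eq, Matrix.add_mulVec, ← Matrix.mulVec_mulVec]
  refine (nsq_add_le _ _).trans ?_
  have h1 : nsq ((Idiff n M S μ)ᴴ *ᵥ (Idiff n M S μ *ᵥ A)) ≤ 16 * (n : ℝ) ^ 4 * nsq A := by
    have hH : ‖(Idiff n M S μ)ᴴ‖ ≤ 2 * (n : ℝ) := by rw [Matrix.l2_opNorm_conjTranspose]; exact opNorm_Idiff_le n M S μ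
    have s1 := nsq_mulVec_le ((Idiff n M S μ)ᴴ) (Idiff n M S μ *ᵥ A)
    have s2 : nsq (Idiff n M S μ *ᵥ A) ≤ 4 * (n : ℝ) ^ 2 * nsq A := by rw [Idiff_mulVec]; exact nsq_igrad_le n M S μ A
    have s3 : ‖(Idiff n M S μ)ᴴ‖ ^ 2 ≤ (2 * (n : ℝ)) ^ 2 := pow_le_pow_left₀ (norm_nonneg _) hH 2
    have hA := nsq_nonneg A
    calc _ ≤ ‖(Idiff n M S μ)ᴴ‖ ^ 2 * nsq (Idiff n M S μ *ᵥ A) := s1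
      _ ≤ (2 * (n : ℝ)) ^ 2 * (4 * (n : ℝ) ^ 2 * nsq A) :=
          mul_le_mul s3 s2 (nsq_nonneg _) (sq_nonneg _)
      _ = 16 * (n : ℝ) ^ 4 * nsq A := by ring
  have h2 : nsq (Dg n M S μ *ᵥ A) ≤ 4 * (n : ℝ) ^ 4 * nsq A := by
    unfold nsq Dg
    rw [mul_sum]
    refine sum_le_sum fun b _ => ?_
    rw [Matrix.mulVec_diagonal, norm_mul, mul_pow, Complex.norm_real, Real.norm_of_nonneg
      (mul_nonneg (sq_nonneg _) (tcnt_nonneg n M S μ b.1))]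
    have ht := tcnt_le_two n M S μ b.1
    have ht0 := tcnt_nonneg n M S μ b.1
    have hA : 0 ≤ ‖A b‖ ^ 2 := sq_nonneg _
    have ht2 : tcnt n M S μ b.1 ^ 2 ≤ 4 := by nlinarith
    have : ((n : ℝ) ^ 2 * tcnt n M S μ b.1) ^ 2 ≤ 4 * (n : ℝ) ^ 4 := by
      have e : ((n : ℝ) ^ 2 * tcnt n M S μ b.1) ^ 2 = (n : ℝ) ^ 4 * tcnt n M S μ b.1 ^ 2 := by ring
      rw [e]
      calc (n : ℝ) ^ 4 * tcnt n M S μ b.1 ^ 2 ≤ (n : ℝ) ^ 4 * 4 := mul_le_mul_of_nonneg_left ht2 (by positivity)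
        _ = 4 * (n : ℝ) ^ 4 := by ring
    exact mul_le_mul_of_nonneg_right this hA
  linarith

end Region

/-! ## §3 The box tower: every budget of `G̃_k` with one constant, and the (R-loc) socket -/

section Tower

variable (L : ℕ) [NeZero L] (M : Fin d → ℕ) [hM : ∀ μ, NeZero (M μ)] (S : Tor M → Prop) [DecidablePred S] (a a' : ℝ)

/-- `‖G̃_k f‖² ≤ γ⋆⁻²‖f‖²` (`γ⋆ = gamStar d a′ (cW1box d a a′ 4)`), every level. [folklore] -/
theorem nsq_loc_inv_le (hL : 2 ≤ L) (hbox : IsCoordBox M S) (ha : 0 < a) (ha' : 0 < a') (k : ℕ)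
    (f : {b // starReg (lev L k) M S b} → ℂ) :
    nsq ((regionDeltaLoc (lev L k) M a S)⁻¹ *ᵥ f) ≤ ((gamStar d a' (cW1box d a a' 4))⁻¹) ^ 2 * nsq f :=
  (nsq_mulVec_le _ _).trans (mul_le_mul_of_nonneg_right
    (pow_le_pow_left₀ (norm_nonneg _) (opNorm_inv_regionDeltaLoc_lev_box_le L M S a a' hL hbox ha ha' k).2 2) (nsq_nonneg _))

/-- **THE ENERGY BUDGET**: `re⟨A, Δ_loc A⟩ ≤ γ⋆⁻¹‖f‖²` for `A = G̃_k f`, every level `k`. [folklore] -/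
theorem form_loc_inv_le (hL : 2 ≤ L) (hbox : IsCoordBox M S) (ha : 0 < a) (ha' : 0 < a') (k : ℕ)
    (f : {b // starReg (lev L k) M S b} → ℂ) :
    (star ((regionDeltaLoc (lev L k) M a S)⁻¹ *ᵥ f)
        ⬝ᵥ (regionDeltaLoc (lev L k) M a S *ᵥ ((regionDeltaLoc (lev L k) M a S)⁻¹ *ᵥ f))).re
      ≤ (gamStar d a' (cW1box d a a' 4))⁻¹ * nsq f :=
  form_inv_le_of_coercive (lev L k) M S (gamStar_pos (d := d) a' (cW1box_pos (d := d) a a' (Cf := 4) ha ha'))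
    (coercive_regionDeltaLoc_lev_box L M S a a' hL hbox ha ha' k).2 f

/-- **THE ELECTRIC BUDGET**: `‖curlR G̃_kf‖² + ‖gradRᴴ G̃_kf‖² ≤ γ⋆⁻¹‖f‖²`, every level `k`. [folklore] -/
theorem electric_loc_inv_le (hL : 2 ≤ L) (hbox : IsCoordBox M S) (ha : 0 < a) (ha' : 0 < a') (k : ℕ)
    (f : {b // starReg (lev L k) M S b} → ℂ) :
    nsq (curlR (lev L k) M S *ᵥ ((regionDeltaLoc (lev L k) M a S)⁻¹ *ᵥ f))
        + nsq ((gradR (lev L k) M S)ᴴ *ᵥ ((regionDeltaLoc (lev L k) M a S)⁻¹ *ᵥ f))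
      ≤ (gamStar d a' (cW1box d a a' 4))⁻¹ * nsq f :=
  (electric_le_form_loc (lev L k) M S ha.le _).trans (form_loc_inv_le L M S a a' hL hbox ha ha' k f)

/-- **THE INTERIOR-GRADIENT BUDGET** (levels `k + 1`, where H1 holds; the owner's `interiorW2_loc` + the energy budget):
`Σ_μ ‖igrad_μ G̃_{k+1}f‖² ≤ γ⋆⁻¹‖f‖²`. [folklore] -/
theorem sum_nsq_igrad_loc_inv_le (hL : 2 ≤ L) (hbox : IsCoordBox M S) (ha : 0 < a) (ha' : 0 < a') (k : ℕ)
    (f : {b // starReg (lev L (k + 1)) M S b} → ℂ) :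
    ∑ μ, nsq (igrad M S (lev L (k + 1)) μ ((regionDeltaLoc (lev L (k + 1)) M a S)⁻¹ *ᵥ f))
      ≤ (gamStar d a' (cW1box d a a' 4))⁻¹ * nsq f :=
  (interiorW2_loc (lev L (k + 1)) M a S
      (atMostOneNeighbour_of_isCoordBox (lev L (k + 1)) M S (two_le_lev_succ L hL k) hbox) ha.le _).trans
    (form_loc_inv_le L M S a a' hL hbox ha ha' (k + 1) f)

/-- **THE TRANSVERSE-CHARGE BUDGET** (levels `k + 1`): `Σ_μ n²·Σ_b tcnt μ b‖(G̃_{k+1}f) b‖² ≤ γ⋆⁻¹‖f‖²` — the tangential boundary layers of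
`G̃f` are `O(n⁻¹)` in mean square. [folklore] -/
theorem tcharge_loc_inv_le (hL : 2 ≤ L) (hbox : IsCoordBox M S) (ha : 0 < a) (ha' : 0 < a') (k : ℕ)
    (f : {b // starReg (lev L (k + 1)) M S b} → ℂ) :
    ∑ μ, ((lev L (k + 1) : ℕ) : ℝ) ^ 2 * ∑ b : {b // starReg (lev L (k + 1)) M S b},
        tcnt (lev L (k + 1)) M S μ b.1 * ‖((regionDeltaLoc (lev L (k + 1)) M a S)⁻¹ *ᵥ f) b‖ ^ 2
      ≤ (gamStar d a' (cW1box d a a' 4))⁻¹ * nsq f :=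
  (tcharge_le_form_loc (lev L (k + 1)) M S
      (atMostOneNeighbour_of_isCoordBox (lev L (k + 1)) M S (two_le_lev_succ L hL k) hbox) ha.le _).trans
    (form_loc_inv_le L M S a a' hL hbox ha ha' (k + 1) f)

/-- **THE DIRECTIONAL-HESSIAN BUDGET** (levels `k + 1`): `√(Σ_μ ‖W_μ G̃_{k+1}f‖²) ≤ (1 + a·γ⋆⁻¹)·‖f‖` with the TOWER constant
`γ⋆ = gamStar d a′ (cW1box d a a′ 4)` (file 3's `hessian_budget_loc` with `Γ = γ⋆⁻¹`). [folklore] -/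
theorem hessian_loc_inv_le (hL : 2 ≤ L) (hbox : IsCoordBox M S) (ha : 0 < a) (ha' : 0 < a') (k : ℕ)
    (f : {b // starReg (lev L (k + 1)) M S b} → ℂ) :
    Real.sqrt (∑ μ, nsq (Wdir (lev L (k + 1)) M S μ *ᵥ ((regionDeltaLoc (lev L (k + 1)) M a S)⁻¹ *ᵥ f)))
      ≤ (1 + a * (gamStar d a' (cW1box d a a' 4))⁻¹) * Real.sqrt (nsq f) := by
  obtain ⟨hunit, hΓ⟩ := opNorm_inv_regionDeltaLoc_lev_box_le L M S a a' hL hbox ha ha' (k + 1)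
  exact hessian_budget_loc (lev L (k + 1)) M S (two_le_lev_succ L hL k) hbox ha.le hunit hΓ f

/-- the crude directional-Hessian bound at every level (no H1): `Σ_μ ‖W_μ G̃_k f‖² ≤ 40·d·n_k⁴·γ⋆⁻²·‖f‖²`. [folklore] -/
theorem hessian_loc_inv_le_crude (hL : 2 ≤ L) (hbox : IsCoordBox M S) (ha : 0 < a) (ha' : 0 < a') (k : ℕ)
    (f : {b // starReg (lev L k) M S b} → ℂ) :
    ∑ μ, nsq (Wdir (lev L k) M S μ *ᵥ ((regionDeltaLoc (lev L k) M a S)⁻¹ *ᵥ f))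
      ≤ 40 * d * ((lev L k : ℕ) : ℝ) ^ 4 * ((gamStar d a' (cW1box d a a' 4))⁻¹) ^ 2 * nsq f := by
  have h1 := nsq_loc_inv_le L M S a a' hL hbox ha ha' k f
  calc ∑ μ, nsq (Wdir (lev L k) M S μ *ᵥ ((regionDeltaLoc (lev L k) M a S)⁻¹ *ᵥ f))
      ≤ ∑ _μ : Fin d, 40 * ((lev L k : ℕ) : ℝ) ^ 4 * (((gamStar d a' (cW1box d a a' 4))⁻¹) ^ 2 * nsq f) :=
        sum_le_sum fun μ _ => (nsq_Wdir_mulVec_le (lev L k) M S μ _).trans (mul_le_mul_of_nonneg_left h1 (by positivity))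
    _ = 40 * d * ((lev L k : ℕ) : ℝ) ^ 4 * ((gamStar d a' (cW1box d a a' 4))⁻¹) ^ 2 * nsq f := by
        rw [sum_const, card_univ, Fintype.card_fin, nsmul_eq_mul]; ring

/-- the (R-loc) constant `CHbox = 1 + (a + 7d)·γ⋆⁻¹`. [folklore] -/
def CHbox (d : ℕ) (a a' : ℝ) : ℝ := 1 + (a + 7 * d) * (gamStar d a' (cW1box d a a' 4))⁻¹

/-- **THE (R-loc) SOCKET OF THE OWNER's LOCAL ASSEMBLY (O15-c `hRH`), DISCHARGED ON EVERY COORDINATE BOX**: for `L ≥ 2`, `0 < a`, `0 < a′`,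
`∀ k f, Σ_μ nsq (Wdir (lev L k) M S μ *ᵥ ((regionDeltaLoc (lev L k) M a S)⁻¹ *ᵥ f)) ≤ (CHbox d a a′)² * nsq f` — level `0` by the crude unit-lattice
bound, levels `k + 1` by the corner-free H². [folklore] -/
theorem hRH_box (hL : 2 ≤ L) (hbox : IsCoordBox M S) (ha : 0 < a) (ha' : 0 < a') :
    ∀ (k : ℕ) (f : pidx L M (starP L M S) k → ℂ),
      ∑ μ, nsq (Wdir (lev L k) M S μ *ᵥ ((regionDeltaLoc (lev L k) M a S)⁻¹ *ᵥ f)) ≤ (CHbox d a a') ^ 2 * nsq f := by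
  have hγ := gamStar_pos (d := d) a' (cW1box_pos (d := d) a a' (Cf := 4) ha ha')
  set g := (gamStar d a' (cW1box d a a' 4))⁻¹ with hg
  have hg0 : 0 < g := inv_pos.mpr hγ
  have hd : (0 : ℝ) ≤ d := Nat.cast_nonneg _
  intro k f
  have hf := nsq_nonneg f
  cases k with
  | zero =>
    have h1 := hessian_loc_inv_le_crude L M S a a' hL hbox ha ha' 0 f
    have hlev : ((lev L 0 : ℕ) : ℝ) = 1 := by norm_num [lev]
    rw [hlev, one_pow, mul_one] at h1
    refine h1.trans (mul_le_mul_of_nonneg_right ?_ hf)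
    -- `40 d g² ≤ (1 + (a + 7d) g)²`
    have h40 : (40 : ℝ) * d ≤ 49 * d ^ 2 := by
      rcases Nat.eq_zero_or_pos d with h0 | hpos
      · subst h0; norm_num
      · have : (1 : ℝ) ≤ d := by exact_mod_cast hpos
        nlinarith
    unfold CHbox
    rw [← hg]
    nlinarith [mul_nonneg ha.le hg0.le, mul_nonneg hd hg0.le, sq_nonneg g, mul_nonneg (mul_nonneg hd hd) (sq_nonneg g)]
  | succ k =>
    have h1 := hessian_loc_inv_le L M S a a' hL hbox ha ha' k f
    have hX := sum_nonneg fun μ (_ : μ ∈ (univ : Finset (Fin d))) =>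
      nsq_nonneg (Wdir (lev L (k + 1)) M S μ *ᵥ ((regionDeltaLoc (lev L (k + 1)) M a S)⁻¹ *ᵥ f))
    have hc0 : 0 ≤ 1 + a * g := by nlinarith [mul_nonneg ha.le hg0.le]
    have h2 := pow_le_pow_left₀ (Real.sqrt_nonneg _) h1 2
    rw [Real.sq_sqrt hX, mul_pow, Real.sq_sqrt hf] at h2
    refine h2.trans (mul_le_mul_of_nonneg_right (pow_le_pow_left₀ hc0 ?_ 2) hf)
    unfold CHbox
    rw [← hg]
    nlinarith [mul_nonneg hd hg0.le]

end Tower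

end Summit.QuantumFields.BalabanUV.T4Continuum.RegionLocalBudgets

end
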